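import Literature.AlgebraicGeometry.Frobenioids.PadicKummerSettingProofs
import Literature.AlgebraicGeometry.Frobenioids.PadicKummerGalois
import Literature.AnabelianGeometry.AbsoluteAnabelian.MLFGaloisGroups
import HarnessLib

/-!
# Frobenioids II, Theorem 2.4 (i): "`p₁ = p₂`" from [AbsAnab] Prop. 1.2.1 (i), and Theorem 2.4 (i)
# for contexts whose `G` is the absolute Galois group of an MLF

Mochizuki, *The geometry of Frobenioids II*, Kyushu J. Math. **62** (2008) 401–460, §2, Theorem 2.4
(i) pp. 19–20 [cite: MochizukiFrdII2008, Thm 2.4 (i) p.20]: "The fact that `p₁ = p₂` follows from the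
existence of the isomorphism `G₁ ⥲ G₂` [cf. [AbsAnab], Proposition 1.2.1, (i)]."

PROOF-ONLY companion (seat abc-iut-L1-d4, gen 2). For Definition 2.2 contexts `Xᵢ` whose group
`Gᵢ` is identified (topologically) with the absolute Galois group `G_{Kᵢ}` of a finite extension
`Kᵢ` of `ℚ_{pᵢ}` — e.g. abc-iut-L1-t7's Galois binding `Def22Context.ofGalois`
(`PadicKummerGalois.lean`, where `G := G_K` on the nose and the identification is
`ContinuousMulEquiv.refl _`) — the hypothesis `p₁ = p₂` of `Iso.thm24i_of_inputs`
(`PadicKummerSettingProofs.lean`) is DISCHARGED from the tree's named fact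
`galoisMLF_iso_residueChar_eq` (= [AbsAnab] Prop. 1.2.1 (i), abc-iut-L4-t4, `MLFGaloisGroups.lean`;
proved there conditionally on the LCFT rank formula, `galoisMLF_iso_residueChar_eq_of_rank`)
applied to `G_{K₁} ≅ G₁ ⥲ G₂ ≅ G_{K₂}` — exactly the printed deduction (`residueChar_eq_of_iso`,
`thm24i_of_galois_inputs`, `thm24iExistsData_of_galois_inputs`; and `residueChar_eq_of_iso_ofGalois`
at the binding). The identifications `Gᵢ ≃ₜ* G_{Kᵢ}` are explicit arguments (binding-agnostic
phrasing: at `ofGalois` they are `ContinuousMulEquiv.refl _`; this also keeps the cohomological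
binders on the `Def22Context` API, cf. the instance caveat in `PadicKummerGalois.lean`). Still
hypothetical and named in the signatures: "`Φ₁` fieldwise saturated iff `Φ₂`" ([FrdI] Cor.
4.10/4.11 — about the divisor monoids of the `pᵢ`-adic Frobenioids, not visible at the Galois level)
and the naturality of the local-duality isomorphisms (LCFT, [NSW] 7.2.6). Nothing here concerns
[IUTchIII]; no statement of abc-iut-L1-t7 or abc-iut-L4-t4 is restated.
-/

namespace Literature.AlgebraicGeometry.Frobenioids

namespace PadicKummer

open Field Kummer
open Literature.AnabelianGeometry.AbsoluteAnabelian

namespace Def22Context.Iso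

variable (p₁ p₂ : ℕ) [Fact p₁.Prime] [Fact p₂.Prime]
  (K₁ : Type) [Field K₁] [Algebra ℚ_[p₁] K₁] [FiniteDimensional ℚ_[p₁] K₁]
  (K₂ : Type) [Field K₂] [Algebra ℚ_[p₂] K₂] [FiniteDimensional ℚ_[p₂] K₂]
  {X₁ X₂ : Def22Context} (e : Def22Context.Iso X₁ X₂)
  (g₁ : X₁.G ≃ₜ* absoluteGaloisGroup K₁) (g₂ : X₂.G ≃ₜ* absoluteGaloisGroup K₂)

include e g₁ g₂ in
/-- **Theorem 2.4 (i), "`p₁ = p₂`"** (FrdII p. 20): if the groups `Gᵢ` of the two contexts are the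
absolute Galois groups of finite extensions `Kᵢ/ℚ_{pᵢ}`, an isomorphism of contexts gives
`G_{K₁} ≅ G₁ ⥲ G₂ ≅ G_{K₂}`, so [AbsAnab] Prop. 1.2.1 (i) (the tree's named fact
`galoisMLF_iso_residueChar_eq`) yields `p₁ = p₂`. [cite: MochizukiFrdII2008, Thm 2.4 (i) p.20] -/
theorem residueChar_eq_of_iso (h121 : galoisMLF_iso_residueChar_eq) : p₁ = p₂ :=
  h121 p₁ p₂ K₁ K₂ ⟨(g₁.symm.trans e.isoG).trans g₂⟩

include g₁ g₂ in
/-- **Theorem 2.4 (i)** (FrdII pp. 19–20) for contexts over MLF Galois groups, with the input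
`p₁ = p₂` DERIVED from [AbsAnab] Prop. 1.2.1 (i) (`h121 : galoisMLF_iso_residueChar_eq`); the
remaining named inputs are "`Φ₁` fieldwise saturated iff `Φ₂`" (`hfs`, [FrdI] Cor. 4.10/4.11) and
the naturality of the local-duality isomorphisms (`hι`, LCFT [NSW] 7.2.6); everything else —
saturation transfer, the five isomorphisms, Kummer compatibility — is proved
(`PadicKummerIsoTransport.lean`). [cite: MochizukiFrdII2008, Thm 2.4 (i) p.19] -/
theorem thm24i_of_galois_inputs (h121 : galoisMLF_iso_residueChar_eq) (N : ℕ) (fs₁ fs₂ : Prop)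
    (ι₁ : DualityIso N X₁.O X₁.HA X₁.qHA) (ι₂ : DualityIso N X₂.O X₂.HA X₂.qHA) (hfs : fs₁ ↔ fs₂)
    (hι : ∀ c, (e.thm24Data N).recTargetMap (ι₁.toAddEquiv c) = ι₂.toAddEquiv (e.isoH1 N c)) :
    Thm24i X₁ X₂ N p₁ p₂ fs₁ fs₂ (e.thm24Data N) ι₁ ι₂ :=
  e.thm24i_of_inputs N p₁ p₂ fs₁ fs₂ ι₁ ι₂ (residueChar_eq_of_iso p₁ p₂ K₁ K₂ e g₁ g₂ h121) hfs hι

include g₁ g₂ in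
/-- **Theorem 2.4 (i), existence form** for contexts over MLF Galois groups, `p₁ = p₂` derived from
[AbsAnab] Prop. 1.2.1 (i). [cite: MochizukiFrdII2008, Thm 2.4 (i) p.19] -/
theorem thm24iExistsData_of_galois_inputs (h121 : galoisMLF_iso_residueChar_eq) (fs₁ fs₂ : Prop)
    (ι₁ : ∀ N, DualityIso N X₁.O X₁.HA X₁.qHA) (ι₂ : ∀ N, DualityIso N X₂.O X₂.HA X₂.qHA)
    (hfs : fs₁ ↔ fs₂)
    (hι : ∀ N, 0 < N → ∀ c,
      (e.thm24Data N).recTargetMap ((ι₁ N).toAddEquiv c) = (ι₂ N).toAddEquiv (e.isoH1 N c)) :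
    Thm24iExistsData X₁ X₂ p₁ p₂ fs₁ fs₂ ι₁ ι₂ :=
  e.thm24iExistsData_of_inputs p₁ p₂ fs₁ fs₂ ι₁ ι₂
    (residueChar_eq_of_iso p₁ p₂ K₁ K₂ e g₁ g₂ h121) hfs hι

end Def22Context.Iso

/-! ### At abc-iut-L1-t7's Galois binding `Def22Context.ofGalois` (`G := G_K` on the nose) -/

namespace Def22Context

variable {p₁ p₂ : ℕ} [Fact p₁.Prime] [Fact p₂.Prime]
  {K₁ : Type} [Field K₁] [Algebra ℚ_[p₁] K₁] [FiniteDimensional ℚ_[p₁] K₁]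
  {K₂ : Type} [Field K₂] [Algebra ℚ_[p₂] K₂] [FiniteDimensional ℚ_[p₂] K₂]
  {L₁ : IntermediateField K₁ (AlgebraicClosure K₁)} [Normal K₁ L₁] [FiniteDimensional K₁ L₁]
  {H₁ : Subgroup (absoluteGaloisGroup K₁)} [H₁.Normal]
  {hH₁ : IsOpen (H₁ : Set (absoluteGaloisGroup K₁))}
  {AutC₁ O₁ : Type} [Group AutC₁] [CommMonoid O₁] [IsCancelMul O₁] [MulDistribMulAction AutC₁ O₁]
  [MulDistribMulAction (L₁ ≃ₐ[K₁] L₁) O₁] {res₁ : AutC₁ →* (L₁ ≃ₐ[K₁] L₁)}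
  {res_smul₁ : ∀ (α : AutC₁) (x : O₁), res₁ α • x = α • x}
  {L₂ : IntermediateField K₂ (AlgebraicClosure K₂)} [Normal K₂ L₂] [FiniteDimensional K₂ L₂]
  {H₂ : Subgroup (absoluteGaloisGroup K₂)} [H₂.Normal]
  {hH₂ : IsOpen (H₂ : Set (absoluteGaloisGroup K₂))}
  {AutC₂ O₂ : Type} [Group AutC₂] [CommMonoid O₂] [IsCancelMul O₂] [MulDistribMulAction AutC₂ O₂]
  [MulDistribMulAction (L₂ ≃ₐ[K₂] L₂) O₂] {res₂ : AutC₂ →* (L₂ ≃ₐ[K₂] L₂)}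
  {res_smul₂ : ∀ (α : AutC₂) (x : O₂), res₂ α • x = α • x}
  (e : Iso (ofGalois L₁ H₁ hH₁ res₁ res_smul₁) (ofGalois L₂ H₂ hH₂ res₂ res_smul₂))

include e in
/-- **Theorem 2.4 (i), "`p₁ = p₂`", at the Galois binding**: an isomorphism of the contexts
`ofGalois …` of objects over base fields `Kᵢ ⊇ ℚ_{pᵢ}` contains `G_{K₁} ⥲ G_{K₂}`; [AbsAnab]
Prop. 1.2.1 (i) gives `p₁ = p₂`. [cite: MochizukiFrdII2008, Thm 2.4 (i) p.20] -/
theorem residueChar_eq_of_iso_ofGalois (h121 : galoisMLF_iso_residueChar_eq) : p₁ = p₂ :=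
  Iso.residueChar_eq_of_iso p₁ p₂ K₁ K₂ e (ContinuousMulEquiv.refl _) (ContinuousMulEquiv.refl _)
    h121

end Def22Context

end PadicKummer

end Literature.AlgebraicGeometry.Frobenioids
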